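import Summits.HodgeConjecture.HodgeConjecture.Theses.KulikovCuspKugaSatake
import HarnessLib

/-!
# Assembly of route `KulikovCuspKugaSatake` (stmt-HodgeConjecture-18402)

The assembly item of route `KulikovCuspKugaSatake` is, verbatim, the curried form of the route file's deciding
theorem `closes` (sorry-free in `Theses/KulikovCuspKugaSatake.lean`, where the assembly — strong induction on
`r = rk T(S)_ℚ` from `RankSixBase`, `NLAnchor`, `CuspStep`, then `SectorComplement` — is proved inline); this file
records it as a theorem so the item closes. No mathematics beyond the route file's own `closes`.
-/

set_option linter.dupNamespace false

namespace Summit.HodgeConjecture.HodgeConjecture.Theorems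

/-- **Assembly of route `KulikovCuspKugaSatake`** (item stmt-HodgeConjecture-18402):
`RankSixBase → NLAnchor → CuspStep → SectorComplement → HodgeConjecture`, exactly as composed by the route file's
deciding theorem `Summit.HodgeConjecture.HodgeConjecture.Theses.KulikovCuspKugaSatake.closes`, of which this is
the curried restatement. -/
theorem kulikovCuspKugaSatake_assembly_proof :
    Summit.HodgeConjecture.HodgeConjecture.Theses.KulikovCuspKugaSatake.Assembly :=
  fun hBase hNL hCusp hC ↦
    Summit.HodgeConjecture.HodgeConjecture.Theses.KulikovCuspKugaSatake.closes hBase hNL hCusp hC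

end Summit.HodgeConjecture.HodgeConjecture.Theorems
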